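import Summits.CriticalPhenomena.PercolationContinuityZ3.Theorems.PercNearOneGluingNoHeavyQuantPairFlowAlgebra
import HarnessLib

/-!
# QUANT lane R8, T-DEC: THE HYPER-FLOW CERTIFICATE — drop a SET of siblings and boost one: for every width, a nonnegative flow on hyperedges
# `(D, j)` with unit node balance and subset balance is a kernel instance of the sibling step at the TRUE floor, GIVEN the oracle

builds on p205010 (kernel theorem, internal audit signed; external expert review pending)

Support file (`--supports stmt-CriticalPhenomena-4575`), QUANT lane seat prim-quant-census-1 (gen 27), rung R8 of
`run/shared/lean/prim/quant/LADDER.md`; memo `run/shared/lean/prim/quant/prim-quant-census-1/g27/PAIRFLOW-G27.md` §6.  Theorems only, standard axioms,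
no sorries.  An INSTANCE, for every width, of ✓ `…QuantSubproductMixture` (`sdec_flaw_of_subproductMix`, p503068); it generalises ✓ `…QuantPairFlowCertificate`
(`sdec_flaw_of_pairFlow`, p513450: hyperedges with `|D| = 1`, all ordered pairs) in two ways — the dropped set `D` is arbitrary (down to the single-sibling
column `D = [k]∖{j}`, openness `fmean/m_j`), and legality is asked only on the hyperedges USED (the index set `H` is a parameter).

THE COMPONENTS.  `Q_{D,j}` (`j ∉ D ≠ ∅`): drop the siblings in `D`, open sibling `j` with probability `q_j + M_D/m_j`, `M_D = Σ_{d∈D} q_d m_d` (gated mean exactly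
`fmean`; legal iff `q_j m_j + M_D ≤ m_j`); open sets `B`, `|B| ≥ 2`.  With weight `u_{D,j} = ε·s_{D,j}·Π_{d∈D}(1−q_d)·(1−q_j)q_j m_j/M_D` the component puts mass
`π(S)·ε·(τ_{D,j} + [j ∈ S]·s_{D,j})` on every pattern `S` disjoint from `D` (`τ_{D,j}·M_D = s_{D,j}·q_j((1−q_j)m_j − M_D)`, `hyperFlow_component_mass`) and none on
the others; hence (`ε = 1/(1 + Σ τ)`) the sub-product identity on non-empty patterns holds with nonnegative open-set weights iff
    (N_a)  `IN({a}) = 1 + LOSS({a})`  for every sibling `a`,      (B_S)  `IN(S) ≤ 1 + LOSS(S)`  for every `S` with `|S| ≥ 2`,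
where `IN(S) = Σ_{D∩S=∅, j∈S} s_{D,j}` (flow INTO `S` from hyperedges disjoint from `S`) and `LOSS(S) = Σ_{D∩S≠∅} τ_{D,j}`.  For `|D| ≡ 1` (B_S) follows from the
pair coverage `s_{a,b} + s_{b,a} ≥ 1` (part 2).  CENSUS (exact LP, census-1 g27 `code/multidrop_test.py`): multi-drop columns ENLARGE the boosted dictionary's reach —
k = 4 wide-gate ensemble 22 → 39 (+ triple drops 41) of 300 groups, k = 5 equal means 29 → 40 of 60, k = 5 wide 2 → 7 of 150 — while over-boosted /
'drop d, open j' columns add nothing (affine in the openness).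

* **`sdec_flaw_of_hyperFlow`**: `0 < x < 1`; `L` tree-built at `x`, `2 ≤ |L|`; a finite set `H` of legal hyperedges `(D, j)`; flows `s ≥ 0` and losses `τ` on `H`
  (`τ_p·M_D = s_p·q_j((1−q_j)m_j − M_D)`) with (N) and (B); pair means `≥ fmean L`; the floor condition `x·Σ mᵢ ≤ fmean L·x₁ᵢ`; the oracle below `fgates L`
  ⟹ `SDEC x (ftop L) (flaw L)`.

HONEST STATUS.  A k-general sub-family of the open core; `SiblingStep` ⟺ `GateStepN`, `UPartStep`, `LightResidDECOracle`, `FarTreeRow` remain OPEN; RATE class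
(log\*) and the honest sentence of `run/shared/lean/prim/quant/README.md` unchanged.  [this work]; nothing here is cited as a published result.  The gluing rows
served [cite: KozmaNitzan2024, Conjecture 3 (p. 15)]; product measure [cite: Grimmett1999, §1.3 p. 10].
-/

noncomputable section

open scoped BigOperators

namespace Summit.CriticalPhenomena.PercolationContinuityZ3.Theorems
namespace Quant
namespace LawDec

open Finset

/-- **per-component mass of a multi-drop boosted sub-forest**: dropping `D` and boosting `j ∉ D` to `q_j + M/m_j` with weight
`ε·s·Π_{d∈D}(1−q_d)·(1−q_j)q_j m_j/M` puts mass `π(B)·ε·(s·q_j((1−q_j)m_j − M)/M + [j ∈ B]·s)` on every pattern `B` disjoint from `D`. [this work] -/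
theorem hyperFlow_component_mass {n : ℕ} (q m : Fin n → ℝ) (s ε M : ℝ) (D : Finset (Fin n)) (j : Fin n) (hj : j ∉ D)
    (hM : M ≠ 0) (hmj : m j ≠ 0) (B : Finset (Fin n)) (hDB : Disjoint D B) :
    ε * (s * ((∏ d ∈ D, (1 - q d)) * ((1 - q j) * q j * m j))) / M *
        ((∏ i ∈ B, (if i = j then q j + M / m j else q i)) *
          ∏ i ∈ (Finset.univ \ D) \ B, (1 - (if i = j then q j + M / m j else q i)))
      = ((∏ i ∈ B, q i) * ∏ i ∈ Finset.univ \ B, (1 - q i)) *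
        (ε * (s * (q j * ((1 - q j) * m j - M)) / M + if j ∈ B then s else 0)) := by
  classical
  have hsd : Finset.univ \ B = D ∪ ((Finset.univ \ D) \ B) := by
    ext i
    by_cases hiD : i ∈ D
    · have hiB : i ∉ B := Finset.disjoint_left.1 hDB hiD
      simp [hiD, hiB]
    · simp [hiD]
  have hdisj : Disjoint D ((Finset.univ \ D) \ B) :=
    Finset.disjoint_left.2 fun i hi hi' => (Finset.mem_sdiff.1 (Finset.mem_sdiff.1 hi').1).2 hi
  rw [hsd, Finset.prod_union hdisj]
  have e1 : ∀ i ∈ (Finset.univ \ D) \ B, (1 - (if i = j then q j + M / m j else q i))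
      = (if i = j then 1 - (q j + M / m j) else 1 - q i) := by
    intro i _; split_ifs <;> rfl
  rw [Finset.prod_congr rfl e1]
  set PD : ℝ := ∏ d ∈ D, (1 - q d) with hPD
  by_cases hjB : j ∈ B
  · have hjn : j ∉ (Finset.univ \ D) \ B := fun h => (Finset.mem_sdiff.1 h).2 hjB
    rw [prod_ite_eq_of_mem B j hjB, prod_ite_eq_of_not_mem _ j hjn, ← Finset.mul_prod_erase B q hjB, if_pos hjB]
    have idA : ε * (s * (PD * ((1 - q j) * q j * m j))) / M * (q j + M / m j)
        = q j * PD * (ε * (s * (q j * ((1 - q j) * m j - M)) / M + s)) := by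
      field_simp
      ring
    calc ε * (s * (PD * ((1 - q j) * q j * m j))) / M
          * ((q j + M / m j) * (∏ i ∈ B.erase j, q i) * ∏ i ∈ (Finset.univ \ D) \ B, (1 - q i))
        = (ε * (s * (PD * ((1 - q j) * q j * m j))) / M * (q j + M / m j))
          * ((∏ i ∈ B.erase j, q i) * ∏ i ∈ (Finset.univ \ D) \ B, (1 - q i)) := by ring
      _ = q j * PD * (ε * (s * (q j * ((1 - q j) * m j - M)) / M + s))
          * ((∏ i ∈ B.erase j, q i) * ∏ i ∈ (Finset.univ \ D) \ B, (1 - q i)) := by rw [idA]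
      _ = _ := by ring
  · have hjT : j ∈ (Finset.univ \ D) \ B :=
      Finset.mem_sdiff.2 ⟨Finset.mem_sdiff.2 ⟨Finset.mem_univ j, hj⟩, hjB⟩
    rw [prod_ite_eq_of_not_mem B j hjB, prod_ite_eq_of_mem _ j hjT (fun i => 1 - q i),
      ← Finset.mul_prod_erase ((Finset.univ \ D) \ B) (fun i => 1 - q i) hjT, if_neg hjB, add_zero]
    have idB : ε * (s * (PD * ((1 - q j) * q j * m j))) / M * (1 - (q j + M / m j))
        = PD * (1 - q j) * (ε * (s * (q j * ((1 - q j) * m j - M)) / M)) := by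
      field_simp
      ring
    calc ε * (s * (PD * ((1 - q j) * q j * m j))) / M
          * ((∏ i ∈ B, q i) * ((1 - (q j + M / m j)) * ∏ i ∈ ((Finset.univ \ D) \ B).erase j, (1 - q i)))
        = (ε * (s * (PD * ((1 - q j) * q j * m j))) / M * (1 - (q j + M / m j)))
          * ((∏ i ∈ B, q i) * ∏ i ∈ ((Finset.univ \ D) \ B).erase j, (1 - q i)) := by ring
      _ = PD * (1 - q j) * (ε * (s * (q j * ((1 - q j) * m j - M)) / M))
          * ((∏ i ∈ B, q i) * ∏ i ∈ ((Finset.univ \ D) \ B).erase j, (1 - q i)) := by rw [idB]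
      _ = _ := by ring

/-- **THE HYPER-FLOW CERTIFICATE (every width; SDEC form, given the oracle).**  See the module docstring: tree-built siblings `L` (`2 ≤ |L|`) at floor `x`;
a finite set `H` of hyperedges `(D, j)` with `j ∉ D ≠ ∅` and legal boosts `q_j m_j + M_D ≤ m_j`; flows `s ≥ 0` and losses `τ` (`τ_p·M_D = s_p·q_j((1−q_j)m_j − M_D)`)
with NODE BALANCE `IN({a}) = 1 + LOSS({a})` and SUBSET BALANCE `IN(S) ≤ 1 + LOSS(S)` (`|S| ≥ 2`); pair means `≥ fmean L`; the floor condition; the oracle below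
`fgates L` ⟹ `SDEC x (ftop L) (flaw L)`. [this work] -/
theorem sdec_flaw_of_hyperFlow {x : ℝ} (hx0 : 0 < x) (hx1 : x < 1) (L : List Sib)
    (hL : ∀ t ∈ L, t.TreeOK x) (hn : 2 ≤ L.length)
    (hO : ∀ (x' : ℝ) (n' M' : ℕ) (μ' : ℕ → ℝ), n' < fgates L → TreeBuiltN x' n' M' μ' → SDEC x' M' μ')
    (hpair : ∀ a b : Fin L.length, a ≠ b → fmean L ≤ (L.get a).mean + (L.get b).mean)
    (hfl : ∀ i : Fin L.length, x * ∑ l, (L.get l).mean ≤ fmean L * (L.get i).x₁)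
    (H : Finset (Finset (Fin L.length) × Fin L.length))
    (hH : ∀ p ∈ H, p.2 ∉ p.1 ∧ p.1.Nonempty ∧
      (L.get p.2).q * (L.get p.2).mean + ∑ d ∈ p.1, (L.get d).q * (L.get d).mean ≤ (L.get p.2).mean)
    (s τ : Finset (Fin L.length) × Fin L.length → ℝ) (hs0 : ∀ p ∈ H, 0 ≤ s p)
    (hτ : ∀ p ∈ H, τ p * ∑ d ∈ p.1, (L.get d).q * (L.get d).mean
      = s p * ((L.get p.2).q * ((1 - (L.get p.2).q) * (L.get p.2).mean - ∑ d ∈ p.1, (L.get d).q * (L.get d).mean)))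
    (hnode : ∀ a : Fin L.length,
      ∑ p ∈ H, (if p.2 = a then s p else 0) = 1 + ∑ p ∈ H, (if a ∈ p.1 then τ p else 0))
    (hsub : ∀ S : Finset (Fin L.length), 2 ≤ S.card →
      ∑ p ∈ H, (if p.1 ∩ S = ∅ ∧ p.2 ∈ S then s p else 0) ≤ 1 + ∑ p ∈ H, (if p.1 ∩ S = ∅ then 0 else τ p)) :
    SDEC x (ftop L) (flaw L) := by
  classical
  have hget : ∀ i : Fin L.length, (L.get i).TreeOK x := fun i => hL _ (List.get_mem L i)
  have hL' : ∀ t ∈ L, t.LawOK := fun t ht => (hL t ht).lawOK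
  set q : Fin L.length → ℝ := fun i => (L.get i).q with hqdef
  set m : Fin L.length → ℝ := fun i => (L.get i).mean with hmdef
  set y : Fin L.length → ℝ := fun i => (L.get i).x₁ with hydef
  have hq0 : ∀ i, 0 < q i := fun i => (hget i).1
  have hq1 : ∀ i, q i < 1 := fun i => (hget i).2.1
  have hxq : ∀ i, x ≤ q i * y i := fun i => (hget i).2.2.1
  have hm0 : ∀ i, 0 < m i := fun i => (L.get i).mean_pos (hget i)
  have hne : L ≠ [] := by
    intro h; have h' := congrArg List.length h; simp only [List.length_nil] at h'; omega
  have hfm : fmean L = ∑ i, q i * m i := fmean_eq_sum_get L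
  have hfm0 : 0 < fmean L := fmean_pos_of_ne_nil L hL' hm0 hne
  set Mtot : ℝ := ∑ i, m i with hMtot
  -- hyperedge data
  set MD : Finset (Fin L.length) × Fin L.length → ℝ := fun p => ∑ d ∈ p.1, q d * m d with hMD
  have hMD0 : ∀ p ∈ H, 0 < MD p := fun p hp =>
    Finset.sum_pos (fun d _ => mul_pos (hq0 d) (hm0 d)) (hH p hp).2.1
  have hτeq : ∀ p ∈ H, τ p = s p * (q p.2 * ((1 - q p.2) * m p.2 - MD p)) / MD p := fun p hp => by
    rw [eq_div_iff (hMD0 p hp).ne']; exact hτ p hp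
  have hτ0 : ∀ p ∈ H, 0 ≤ τ p := by
    intro p hp
    rw [hτeq p hp]
    have h1 : 0 ≤ (1 - q p.2) * m p.2 - MD p := by
      have := (hH p hp).2.2
      show 0 ≤ (1 - (L.get p.2).q) * (L.get p.2).mean - MD p; linarith
    exact div_nonneg (mul_nonneg (hs0 p hp) (mul_nonneg (hq0 _).le h1)) (hMD0 p hp).le
  set T : ℝ := ∑ p ∈ H, τ p with hTdef
  have hT0 : 0 ≤ T := Finset.sum_nonneg hτ0
  set ε : ℝ := 1 / (1 + T) with hεdef
  have hε0 : 0 < ε := by rw [hεdef]; positivity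
  have hεT : ε * (1 + T) = 1 := by rw [hεdef]; field_simp
  -- the certificate data
  set PO : Finset (Finset (Fin L.length)) := (Finset.univ : Finset (Finset (Fin L.length))).filter fun B => 2 ≤ B.card with hPO
  set S : Finset ((Finset (Fin L.length) × Fin L.length) ⊕ Finset (Fin L.length)) := H.image Sum.inl ∪ PO.image Sum.inr with hS
  set uQ : Finset (Fin L.length) × Fin L.length → ℝ := fun p =>
    ε * (s p * ((∏ d ∈ p.1, (1 - q d)) * ((1 - q p.2) * q p.2 * m p.2))) / MD p with huQ
  set oQ : Finset (Fin L.length) × Fin L.length → Fin L.length → ℝ :=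
    fun p i => if i = p.2 then q p.2 + MD p / m p.2 else q i with hoQ
  set PP : Finset (Fin L.length) × Fin L.length → Finset (Fin L.length) → ℝ := fun p B =>
    if B ⊆ Finset.univ \ p.1 then (∏ i ∈ B, oQ p i) * ∏ i ∈ (Finset.univ \ p.1) \ B, (1 - oQ p i) else 0 with hPP
  set piB : Finset (Fin L.length) → ℝ := fun B => (∏ i ∈ B, q i) * ∏ i ∈ Finset.univ \ B, (1 - q i) with hpiB
  set Rh : Finset (Fin L.length) → ℝ := fun B =>
    ∑ p ∈ H, (if p.1 ∩ B = ∅ then τ p + (if p.2 ∈ B then s p else 0) else 0) with hRh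
  set uO : Finset (Fin L.length) → ℝ := fun B => piB B - ∑ p ∈ H, uQ p * PP p B with huO
  set u : (Finset (Fin L.length) × Fin L.length) ⊕ Finset (Fin L.length) → ℝ := Sum.elim uQ uO with hu
  set E : (Finset (Fin L.length) × Fin L.length) ⊕ Finset (Fin L.length) → Finset (Fin L.length) :=
    Sum.elim (fun p => Finset.univ \ p.1) (fun B => B) with hE
  set o : (Finset (Fin L.length) × Fin L.length) ⊕ Finset (Fin L.length) → Fin L.length → ℝ := Sum.elim oQ (fun _ _ => 1) with ho
  set v : (Finset (Fin L.length) × Fin L.length) ⊕ Finset (Fin L.length) → ℝ :=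
    Sum.elim (fun _ => x) (fun _ => x * Mtot / fmean L) with hv
  have hpiB0 : ∀ B, 0 ≤ piB B := fun B =>
    mul_nonneg (Finset.prod_nonneg fun i _ => (hq0 i).le) (Finset.prod_nonneg fun i _ => by linarith [hq1 i])
  have hcase : ∀ c ∈ S, (∃ p ∈ H, c = Sum.inl p) ∨ (∃ B : Finset (Fin L.length), 2 ≤ B.card ∧ c = Sum.inr B) := by
    intro c hc
    rcases Finset.mem_union.1 hc with h | h
    · obtain ⟨p, hp, rfl⟩ := Finset.mem_image.1 h
      exact Or.inl ⟨p, hp, rfl⟩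
    · obtain ⟨B, hB, rfl⟩ := Finset.mem_image.1 h
      exact Or.inr ⟨B, (Finset.mem_filter.1 hB).2, rfl⟩
  have hsumS : ∀ f : (Finset (Fin L.length) × Fin L.length) ⊕ Finset (Fin L.length) → ℝ,
      ∑ c ∈ S, f c = ∑ p ∈ H, f (Sum.inl p) + ∑ B ∈ PO, f (Sum.inr B) := by
    intro f
    rw [hS, Finset.sum_union, Finset.sum_image (fun a _ b _ h => Sum.inl_injective h),
      Finset.sum_image (fun a _ b _ h => Sum.inr_injective h)]
    rw [Finset.disjoint_left]
    intro c hc hc'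
    obtain ⟨p, _, rfl⟩ := Finset.mem_image.1 hc
    obtain ⟨B, _, h⟩ := Finset.mem_image.1 hc'
    exact Sum.inr_ne_inl h
  -- THE KEY PER-COMPONENT IDENTITY
  have hkey : ∀ p ∈ H, ∀ B : Finset (Fin L.length),
      uQ p * PP p B = piB B * (ε * (if p.1 ∩ B = ∅ then τ p + (if p.2 ∈ B then s p else 0) else 0)) := by
    intro p hp B
    obtain ⟨Dp, j⟩ := p
    obtain ⟨hjD, hDne, _⟩ := hH _ hp
    simp only at hjD hDne ⊢
    by_cases hDB : Dp ∩ B = ∅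
    · have hdisj : Disjoint Dp B := Finset.disjoint_iff_inter_eq_empty.2 hDB
      have hsub : B ⊆ Finset.univ \ Dp :=
        fun i hi => Finset.mem_sdiff.2 ⟨Finset.mem_univ i, Finset.disjoint_right.1 hdisj hi⟩
      rw [if_pos hDB, hτeq _ hp]
      show ε * (s (Dp, j) * ((∏ d ∈ Dp, (1 - q d)) * ((1 - q j) * q j * m j))) / MD (Dp, j) *
          (if B ⊆ Finset.univ \ Dp then (∏ i ∈ B, (if i = j then q j + MD (Dp, j) / m j else q i)) *
            ∏ i ∈ (Finset.univ \ Dp) \ B, (1 - (if i = j then q j + MD (Dp, j) / m j else q i)) else 0)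
        = ((∏ i ∈ B, q i) * ∏ i ∈ Finset.univ \ B, (1 - q i)) *
          (ε * (s (Dp, j) * (q j * ((1 - q j) * m j - MD (Dp, j))) / MD (Dp, j) + if j ∈ B then s (Dp, j) else 0))
      rw [if_pos hsub]
      exact hyperFlow_component_mass q m (s (Dp, j)) ε (MD (Dp, j)) Dp j hjD (hMD0 _ hp).ne' (hm0 j).ne' B hdisj
    · have hnot : ¬ B ⊆ Finset.univ \ Dp := by
        intro h
        apply hDB
        exact Finset.eq_empty_of_forall_notMem fun i hi =>
          (Finset.mem_sdiff.1 (h (Finset.mem_inter.1 hi).2)).2 (Finset.mem_inter.1 hi).1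
      rw [if_neg hDB]
      show _ * (if B ⊆ Finset.univ \ Dp then _ else 0) = _
      rw [if_neg hnot]; ring
  have hQsum : ∀ B : Finset (Fin L.length), ∑ p ∈ H, uQ p * PP p B = piB B * (ε * Rh B) := by
    intro B
    rw [hRh]; simp only
    rw [Finset.mul_sum, Finset.mul_sum]
    exact Finset.sum_congr rfl fun p hp => hkey p hp B
  -- `Rh` on a singleton: `1 + T`
  have hRh1 : ∀ a : Fin L.length, Rh {a} = 1 + T := by
    intro a
    have e : ∀ p ∈ H, (if p.1 ∩ {a} = ∅ then τ p + (if p.2 ∈ ({a} : Finset (Fin L.length)) then s p else 0) else 0)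
        = τ p - (if a ∈ p.1 then τ p else 0) + (if p.2 = a then s p else 0) := by
      intro p hp
      by_cases ha : a ∈ p.1
      · have hne' : p.1 ∩ {a} ≠ ∅ := fun h =>
          (Finset.eq_empty_iff_forall_notMem.1 h) a (Finset.mem_inter.2 ⟨ha, Finset.mem_singleton_self a⟩)
        have hja : p.2 ≠ a := fun h => (hH p hp).1 (h ▸ ha)
        rw [if_neg hne', if_pos ha, if_neg hja]; ring
      · have he : p.1 ∩ {a} = ∅ :=
          Finset.eq_empty_of_forall_notMem fun i hi => ha ((Finset.mem_singleton.1 (Finset.mem_inter.1 hi).2) ▸ (Finset.mem_inter.1 hi).1)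
        rw [if_pos he, if_neg ha]
        simp only [Finset.mem_singleton]; ring
    rw [hRh]; simp only
    rw [Finset.sum_congr rfl e, Finset.sum_add_distrib, Finset.sum_sub_distrib, hnode a]
    ring
  -- `Rh` on a set with at least two elements: `≤ 1 + T`
  have hRh2 : ∀ B : Finset (Fin L.length), 2 ≤ B.card → Rh B ≤ 1 + T := by
    intro B hB
    have e : ∀ p ∈ H, (if p.1 ∩ B = ∅ then τ p + (if p.2 ∈ B then s p else 0) else 0)
        = τ p - (if p.1 ∩ B = ∅ then 0 else τ p) + (if p.1 ∩ B = ∅ ∧ p.2 ∈ B then s p else 0) := by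
      intro p _
      by_cases hDB : p.1 ∩ B = ∅
      · rw [if_pos hDB, if_pos hDB]
        by_cases hj : p.2 ∈ B
        · rw [if_pos hj, if_pos ⟨hDB, hj⟩]; ring
        · rw [if_neg hj, if_neg (fun h => hj h.2)]; ring
      · rw [if_neg hDB, if_neg hDB, if_neg (fun h => hDB h.1)]; ring
    rw [hRh]; simp only
    rw [Finset.sum_congr rfl e, Finset.sum_add_distrib, Finset.sum_sub_distrib]
    have := hsub B hB
    linarith
  -- gated means of the components
  have hmeanQ : ∀ p ∈ H, fmean (subRegate L (Finset.univ \ p.1) (oQ p)) = fmean L := by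
    intro p hp
    rw [fmean_subRegate, hfm]
    show ∑ i ∈ Finset.univ \ p.1, (if i = p.2 then q p.2 + MD p / m p.2 else q i) * (L.get i).mean = ∑ i, q i * m i
    have e : ∀ i ∈ Finset.univ \ p.1, (if i = p.2 then q p.2 + MD p / m p.2 else q i) * (L.get i).mean
        = q i * m i + (if i = p.2 then MD p / m p.2 * m p.2 else 0) := by
      intro i _
      show (if i = p.2 then q p.2 + MD p / m p.2 else q i) * m i = _
      split_ifs with h
      · subst h; ring
      · ring
    rw [Finset.sum_congr rfl e, Finset.sum_add_distrib, Finset.sum_ite_eq' (Finset.univ \ p.1) p.2,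
      if_pos (Finset.mem_sdiff.2 ⟨Finset.mem_univ _, (hH p hp).1⟩), div_mul_cancel₀ _ (hm0 _).ne',
      ← Finset.sum_sdiff (Finset.subset_univ p.1)]
  have hmeanO : ∀ B : Finset (Fin L.length), fmean (subRegate L B (fun _ => (1 : ℝ))) = ∑ i ∈ B, m i := by
    intro B; rw [fmean_subRegate_one]
  have huO0 : ∀ B : Finset (Fin L.length), 2 ≤ B.card → 0 ≤ uO B := by
    intro B hB
    show 0 ≤ piB B - ∑ p ∈ H, uQ p * PP p B
    rw [hQsum B]
    have h1 : ε * Rh B ≤ 1 := by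
      calc ε * Rh B ≤ ε * (1 + T) := mul_le_mul_of_nonneg_left (hRh2 B hB) hε0.le
        _ = 1 := hεT
    nlinarith [hpiB0 B]
  refine sdec_flaw_of_subproductMix hx0 hx1 L hL hne hO S u E o ?_ ?_ ?_ ?_ ?_ v ?_ ?_ ?_ ?_
  · intro c hc
    rcases hcase c hc with ⟨p, hp, rfl⟩ | ⟨B, hB, rfl⟩
    · show 0 ≤ ε * (s p * ((∏ d ∈ p.1, (1 - q d)) * ((1 - q p.2) * q p.2 * m p.2))) / MD p
      have := hq1 p.2
      exact div_nonneg (mul_nonneg hε0.le (mul_nonneg (hs0 p hp) (mul_nonneg (Finset.prod_nonneg fun d _ => by linarith [hq1 d])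
        (mul_nonneg (mul_nonneg (by linarith) (hq0 _).le) (hm0 _).le)))) (hMD0 p hp).le
    · exact huO0 B hB
  · intro c hc i hi
    rcases hcase c hc with ⟨p, hp, rfl⟩ | ⟨B, hB, rfl⟩
    · show 0 < (if i = p.2 then q p.2 + MD p / m p.2 else q i)
      split_ifs
      · exact add_pos (hq0 _) (div_pos (hMD0 p hp) (hm0 _))
      · exact hq0 i
    · show (0 : ℝ) < 1; exact one_pos
  · intro c hc i hi
    rcases hcase c hc with ⟨p, hp, rfl⟩ | ⟨B, hB, rfl⟩
    · show (if i = p.2 then q p.2 + MD p / m p.2 else q i) ≤ 1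
      split_ifs
      · have h := (hH p hp).2.2
        have h' : (q p.2 + MD p / m p.2) * m p.2 ≤ 1 * m p.2 := by
          rw [add_mul, div_mul_cancel₀ _ (hm0 _).ne', one_mul]; exact h
        exact le_of_mul_le_mul_right h' (hm0 _)
      · exact (hq1 i).le
    · show (1 : ℝ) ≤ 1; exact le_rfl
  · intro c hc
    rcases hcase c hc with ⟨p, hp, rfl⟩ | ⟨B, hB, rfl⟩
    · obtain ⟨d, hd⟩ := (hH p hp).2.1
      exact ⟨d, Or.inl (show d ∉ Finset.univ \ p.1 from fun h => (Finset.mem_sdiff.1 h).2 hd)⟩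
    · exact ⟨⟨0, by omega⟩, Or.inr rfl⟩
  · -- THE PATTERN IDENTITY
    intro A hA
    have hget' : ((∏ i ∈ A, (L.get i).q) * ∏ i ∈ Finset.univ \ A, (1 - (L.get i).q)) = piB A := rfl
    rw [hget', hsumS]
    have hOpart : ∑ B ∈ PO, u (Sum.inr B) *
        (if A ⊆ E (Sum.inr B) then (∏ i ∈ A, o (Sum.inr B) i) * ∏ i ∈ E (Sum.inr B) \ A, (1 - o (Sum.inr B) i) else 0)
        = if 2 ≤ A.card then uO A else 0 := by
      have term : ∀ B ∈ PO, u (Sum.inr B) *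
          (if A ⊆ E (Sum.inr B) then (∏ i ∈ A, o (Sum.inr B) i) * ∏ i ∈ E (Sum.inr B) \ A, (1 - o (Sum.inr B) i) else 0)
          = if B = A then uO A else 0 := by
        intro B _
        show uO B * (if A ⊆ B then (∏ i ∈ A, (1 : ℝ)) * ∏ i ∈ B \ A, (1 - (1 : ℝ)) else 0) = _
        by_cases hBA : B = A
        · rw [hBA, if_pos (Finset.Subset.refl A), if_pos rfl, Finset.sdiff_self, Finset.prod_empty, Finset.prod_const_one]
          ring
        · rw [if_neg hBA]
          by_cases hAB : A ⊆ B
          · obtain ⟨i, hi⟩ : (B \ A).Nonempty := by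
              rw [Finset.sdiff_nonempty]; intro hBA'; exact hBA (Finset.Subset.antisymm hBA' hAB)
            rw [if_pos hAB, Finset.prod_eq_zero hi (by norm_num), mul_zero, mul_zero]
          · rw [if_neg hAB, mul_zero]
      rw [Finset.sum_congr rfl term, Finset.sum_ite_eq']
      by_cases h2 : 2 ≤ A.card
      · have hmemA : A ∈ PO := Finset.mem_filter.2 ⟨Finset.mem_univ A, h2⟩
        rw [if_pos hmemA, if_pos h2]
      · have hmemA : A ∉ PO := fun h => h2 (Finset.mem_filter.1 h).2
        rw [if_neg hmemA, if_neg h2]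
    rw [hOpart]
    have hQpart : ∑ p ∈ H, u (Sum.inl p) *
        (if A ⊆ E (Sum.inl p) then (∏ i ∈ A, o (Sum.inl p) i) * ∏ i ∈ E (Sum.inl p) \ A, (1 - o (Sum.inl p) i) else 0)
        = ∑ p ∈ H, uQ p * PP p A := rfl
    rw [hQpart]
    by_cases h2 : 2 ≤ A.card
    · rw [if_pos h2]
      show ∑ p ∈ H, uQ p * PP p A + (piB A - ∑ p ∈ H, uQ p * PP p A) = piB A
      ring
    · rw [if_neg h2, add_zero, hQsum A]
      have hc1 : A.card = 1 := le_antisymm (Nat.lt_succ_iff.1 (Nat.lt_of_not_le h2)) (Finset.card_pos.2 hA)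
      obtain ⟨a, ha⟩ : ∃ a, A = {a} := Finset.card_eq_one.1 hc1
      rw [ha, hRh1 a, hεT, mul_one]
  · intro c hc
    rcases hcase c hc with ⟨p, hp, rfl⟩ | ⟨B, hB, rfl⟩
    · exact hx0
    · show 0 < x * Mtot / fmean L
      have hMtot0 : 0 < Mtot := Finset.sum_pos (fun i _ => hm0 i) ⟨⟨0, by omega⟩, Finset.mem_univ _⟩
      positivity
  · intro c hc i hi
    rcases hcase c hc with ⟨p, hp, rfl⟩ | ⟨B, hB, rfl⟩
    · show x ≤ (if i = p.2 then q p.2 + MD p / m p.2 else q i) * (L.get i).x₁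
      split_ifs with h
      · subst h
        have hy : 0 < y p.2 := by obtain ⟨_, _, _, hT, _⟩ := hget p.2; exact hT.lawFacts.1
        have h1 : 0 ≤ MD p / m p.2 * y p.2 := by have := hMD0 p hp; have := hm0 p.2; positivity
        calc x ≤ q p.2 * y p.2 := hxq _
          _ ≤ (q p.2 + MD p / m p.2) * y p.2 := by rw [add_mul]; linarith
      · exact hxq i
    · show x * Mtot / fmean L ≤ 1 * (L.get i).x₁
      rw [one_mul, div_le_iff₀ hfm0]
      calc x * Mtot ≤ fmean L * (L.get i).x₁ := hfl i
        _ = (L.get i).x₁ * fmean L := mul_comm _ _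
  · intro c hc
    rcases hcase c hc with ⟨p, hp, rfl⟩ | ⟨B, hB, rfl⟩
    · show x * fmean (subRegate L (Finset.univ \ p.1) (oQ p)) ≤ fmean L * x
      rw [hmeanQ p hp, mul_comm]
    · show x * fmean (subRegate L B (fun _ => (1 : ℝ))) ≤ fmean L * (x * Mtot / fmean L)
      rw [hmeanO B, mul_div_assoc', mul_div_cancel_left₀ _ hfm0.ne']
      exact mul_le_mul_of_nonneg_left (Finset.sum_le_univ_sum_of_nonneg fun i => (hm0 i).le) hx0.le
  · intro c hc
    rcases hcase c hc with ⟨p, hp, rfl⟩ | ⟨B, hB, rfl⟩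
    · show fmean L ≤ fmean (subRegate L (Finset.univ \ p.1) (oQ p))
      rw [hmeanQ p hp]
    · show fmean L ≤ fmean (subRegate L B (fun _ => (1 : ℝ)))
      rw [hmeanO B]
      obtain ⟨a, ha, b, hb, hab⟩ := Finset.one_lt_card.1 (by omega : 1 < B.card)
      have hsub : ({a, b} : Finset (Fin L.length)) ⊆ B := by
        intro i hi
        rcases Finset.mem_insert.1 hi with rfl | hi
        · exact ha
        · rw [Finset.mem_singleton.1 hi]; exact hb
      calc fmean L ≤ m a + m b := hpair a b hab
        _ = ∑ i ∈ ({a, b} : Finset (Fin L.length)), m i := (Finset.sum_pair hab).symm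
        _ ≤ ∑ i ∈ B, m i := Finset.sum_le_sum_of_subset_of_nonneg hsub fun i _ _ => (hm0 i).le

end LawDec
end Quant
end Summit.CriticalPhenomena.PercolationContinuityZ3.Theorems
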